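import Literature.NumberTheory.Automorphic.Liu2021.Def411AsPrinted
import Literature.RepresentationTheory.Semisimple.IsotypicCutOut
import HarnessLib

/-!
# [Liu2021, Thm. 4.18 (3)] from the main isomorphism and ε-RIGIDITY of the summands under Galois twist

Structural lemma over a [Liu2021, Thm 4.18] datum `D : Thm418Data F E` (`Thm418AsPrinted.lean`); THEOREMS ONLY (no definition, no named fact,
no `sorry`); nothing of [Liu2021] is asserted.

Item (3) of [Liu2021, Thm 4.18] (FJcycle.tex l. 2243): «For every given `ε` that is `μ`-admissible, the subspace `⊕_χ ω(μ, ε, χ)` is stable under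
the action of `Gal(ℂ/M_μ)`», typed in `Thm418AsPrinted` for the main isomorphism `Φ : Ω(μ) ⊗_{M_μ} ℂ ≃ ⊕_{(ε,χ)} ω(μ,ε,χ)` as: if `Φ x` is supported
on the indices with first coordinate `ε`, so is `Φ (σ · x)` (`galoisAct σ = σ ⊗ 1`, READING R4).  Liu's proof (l. 2272–2290: «Since `Gal(ℂ/M_μ)`
stabilizes `μ` and by (2), it suffices to show that … the image of `Gal(ℂ/M_μ)` under the `p`-adic cyclotomic character … is contained in
`ℤ_p^× ∩ Nm_{E_𝔭/F_𝔭} E_𝔭^×`») establishes that the Galois twist `ω(μ,ε,χ)^σ` of an admissible summand is a summand with the SAME `ε`.  This file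
proves the typed item (3) FROM that rigidity, stated as a hypothesis on the datum — «a `σ`-semilinear `𝔾(𝔸_F^∞)`-equivariant bijection
`ω_i → ω_j` between admissible summands forces `i.ε = j.ε`» (the cell `hodgecm-mathlib`'s row III-11 (G2) `EpsRigidUnderGaloisTwist`, hosted in
Literature by B-typ04; here only its TEXT appears, as a hypothesis) — together with [Def 4.11]'s irreducibility of the summands (irreducible OR
zero, `IsIrreducibleOrZero`, `Def411AsPrinted.lean`) and ANY equivariant main isomorphism `Φ`: the `(j → i)`-component of `Φ ∘ (σ ⊗ 1) ∘ Φ⁻¹` is a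
`σ`-semilinear intertwiner `ω_j → ω_i`, hence zero or bijective (Schur, semilinear form: `semilinear_eq_zero_or_bijective`), and bijective forces
`j.ε = i.ε`.  Item (2) (pairwise non-isomorphy) is NOT used.  Consumer: stub G `stub_mainGaloisGlue` of the crux skeleton `Lines/a3-liu418.lean`
(binder `hLiu418`), seat prover-hodgecm-mathlib-A-p19, 2026-08-28.

Also recorded (bookkeeping on `galoisAct`, READING R4 of `Thm418AsPrinted.lean`): `galoisAct σ` is `σ`-semilinear for the `ℂ`-structure
(`galoisAct_smul`) and commutes with the base change of every `M_μ`-linear endomorphism of `Ω(μ)`, in particular with `𝔾(𝔸_F^∞)`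
(`galoisAct_baseChange`); and the equivariant main isomorphism carries the action on `Ω(μ) ⊗ ℂ` to the summand actions index by index
(`symm_lof_rhoAt_local`, a private copy of ✔ `Thm418Data.symm_lof_rhoAt`).

References: [Liu2021] Y. Liu, *Fourier–Jacobi cycles and arithmetic relative trace formula*, Camb. J. Math. 9 (2021), Thm. 4.18 (3) (FJcycle.tex
l. 2243) with proof l. 2272–2290; Def. 4.11; [BushnellHenniart2006] C. Bushnell, G. Henniart, *The local Langlands conjecture for GL(2)*, §41.2 (as
cited by Liu, l. 2281).
-/

set_option autoImplicit false

noncomputable section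

open NumberField TensorProduct DirectSum

namespace Literature.NumberTheory.Automorphic.Liu2021

namespace Thm418Data

variable {F E : Type} [Field F] [NumberField F] [IsTotallyReal F] [Field E] [NumberField E] [Algebra F E]
  [IsTotallyComplex E] [Algebra.IsQuadraticExtension F E] (D : Thm418Data F E)

/-- `σ ⊗ 1` is `σ`-SEMILINEAR for the `ℂ`-structure of `Ω(μ) ⊗_{M_μ} ℂ`: `σ · (c x) = σ(c) (σ · x)` (READING R4 of the typing).
[cite: Liu2021, Thm. 4.18 (3) (l. 2243)] -/
theorem galoisAct_smul (σ : ℂ ≃ₐ[fieldOfValues E D.μ] ℂ) (c : ℂ) (x : ℂ ⊗[fieldOfValues E D.μ] D.Ω) :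
    D.galoisAct σ (c • x) = σ c • D.galoisAct σ x := by
  induction x using TensorProduct.induction_on with
  | zero => simp only [smul_zero, map_zero]
  | tmul z y =>
    rw [TensorProduct.smul_tmul', D.galoisAct_tmul, D.galoisAct_tmul, TensorProduct.smul_tmul', smul_eq_mul, smul_eq_mul,
      map_mul]
  | add x y hx hy => rw [smul_add, map_add, hx, hy, map_add, smul_add]

/-- `σ ⊗ 1` commutes with `f ⊗ 1` for every `M_μ`-linear endomorphism `f` of `Ω(μ)` — in particular with the action of `𝔾(𝔸_F^∞)`
(`(D.rhoΩ g).baseChange ℂ`). [cite: Liu2021, Thm. 4.18 (3) (l. 2243)] -/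
theorem galoisAct_baseChange (σ : ℂ ≃ₐ[fieldOfValues E D.μ] ℂ) (f : D.Ω →ₗ[fieldOfValues E D.μ] D.Ω)
    (x : ℂ ⊗[fieldOfValues E D.μ] D.Ω) :
    D.galoisAct σ (f.baseChange ℂ x) = f.baseChange ℂ (D.galoisAct σ x) := by
  induction x using TensorProduct.induction_on with
  | zero => simp only [map_zero]
  | tmul z y => rw [LinearMap.baseChange_tmul, D.galoisAct_tmul, D.galoisAct_tmul, LinearMap.baseChange_tmul]
  | add x y hx hy => rw [map_add, map_add, hx, hy, map_add, map_add]

/-- An equivariant main isomorphism `Φ : Ω(μ) ⊗ ℂ ≃ ⊕_i ω_i` carries `g ⊗ 1` on `Φ⁻¹(ω_j)` to the action on `ω_j`: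
`Φ⁻¹ (ι_j (g · w)) = (g ⊗ 1) (Φ⁻¹ (ι_j w))` (local copy of ✔ `Thm418Data.symm_lof_rhoAt`, `Thm418BlockLeRange.lean`, kept private to avoid that
module's heavier imports). [cite: Liu2021, Thm. 4.18 (l. 2233–2237)] -/
private theorem symm_lof_rhoAt_local [DecidableEq D.AdmIndex] (Φ : (ℂ ⊗[fieldOfValues E D.μ] D.Ω) ≃ₗ[ℂ] ⨁ i : D.AdmIndex, D.omegaAt i)
    (hΦ : ∀ (g : D.G) (x : ℂ ⊗[fieldOfValues E D.μ] D.Ω) (i : D.AdmIndex), Φ ((D.rhoΩ g).baseChange ℂ x) i = D.rhoAt i g (Φ x i))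
    (j : D.AdmIndex) (g : D.G) (w : D.omegaAt j) :
    Φ.symm (DirectSum.lof ℂ D.AdmIndex (fun i => D.omegaAt i) j (D.rhoAt j g w)) =
      (D.rhoΩ g).baseChange ℂ (Φ.symm (DirectSum.lof ℂ D.AdmIndex (fun i => D.omegaAt i) j w)) := by
  apply Φ.injective
  apply DirectSum.ext
  intro i
  rw [LinearEquiv.apply_symm_apply, hΦ, LinearEquiv.apply_symm_apply, DirectSum.lof_eq_of, DirectSum.lof_eq_of]
  by_cases h : j = i
  · subst h
    rw [DirectSum.of_eq_same, DirectSum.of_eq_same]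
  · rw [DirectSum.of_eq_of_ne _ _ _ (Ne.symm h), DirectSum.of_eq_of_ne _ _ _ (Ne.symm h), map_zero]

/-- **Item (3) of [Liu2021, Thm 4.18] from ε-RIGIDITY under Galois twist.**  For a datum `D` with irreducible-or-zero summands ([Def 4.11]) and
the rigidity «a `σ`-semilinear `𝔾`-equivariant bijection `ω_i → ω_j` of admissible summands forces `i.ε = j.ε`» for every `σ ∈ Gal(ℂ/M_μ)`, EVERY
equivariant main isomorphism `Φ : Ω(μ) ⊗_{M_μ} ℂ ≃ ⊕_i ω_i` has `Gal(ℂ/M_μ)`-stable `ε`-blocks (the typed item (3)).  Route: decompose `x` along `Φ`;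
the `(j → i)`-component of `Φ ∘ (σ ⊗ 1) ∘ Φ⁻¹` is a `σ`-semilinear intertwiner `ω_j → ω_i`, zero or bijective by Schur (semilinear form), and
bijective would give `j.ε = i.ε`. [cite: Liu2021, Thm. 4.18 (3) (FJcycle.tex l. 2243) with proof l. 2272–2290; Def. 4.11] -/
theorem epsBlock_galoisAct_stable_of_epsRigid (hirr : ∀ i : D.AdmIndex, IsIrreducibleOrZero (D.rhoAt i))
    (hrig : ∀ (σ : ℂ ≃ₐ[fieldOfValues E D.μ] ℂ) (i j : D.AdmIndex),
      (∃ f : D.omegaAt i →ₛₗ[(σ : ℂ →+* ℂ)] D.omegaAt j,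
        Function.Bijective f ∧ ∀ (g : D.G) (w : D.omegaAt i), f (D.rhoAt i g w) = D.rhoAt j g (f w)) → i.1.1 = j.1.1)
    (Φ : (ℂ ⊗[fieldOfValues E D.μ] D.Ω) ≃ₗ[ℂ] ⨁ i : D.AdmIndex, D.omegaAt i)
    (hΦ : ∀ (g : D.G) (x : ℂ ⊗[fieldOfValues E D.μ] D.Ω) (i : D.AdmIndex), Φ ((D.rhoΩ g).baseChange ℂ x) i = D.rhoAt i g (Φ x i)) :
    ∀ ε : D.Eps, D.IsAdmissible ε → ∀ (σ : ℂ ≃ₐ[fieldOfValues E D.μ] ℂ) (x : ℂ ⊗[fieldOfValues E D.μ] D.Ω),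
      (∀ i : D.AdmIndex, i.1.1 ≠ ε → Φ x i = 0) → ∀ i : D.AdmIndex, i.1.1 ≠ ε → Φ (D.galoisAct σ x) i = 0 := by
  classical
  intro ε _ σ x hx i hi
  haveI : RingHomSurjective (σ : ℂ →+* ℂ) := ⟨σ.surjective⟩
  -- the `(j → i)`-component of `Φ ∘ (σ ⊗ 1) ∘ Φ⁻¹` vanishes for `j.ε = ε ≠ i.ε`
  have hcomp : ∀ j : D.AdmIndex, j.1.1 = ε → ∀ w : D.omegaAt j,
      Φ (D.galoisAct σ (Φ.symm (DirectSum.lof ℂ D.AdmIndex (fun i => D.omegaAt i) j w))) i = 0 := by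
    intro j hj
    let f : D.omegaAt j →ₛₗ[(σ : ℂ →+* ℂ)] D.omegaAt i :=
      { toFun := fun w => Φ (D.galoisAct σ (Φ.symm (DirectSum.lof ℂ D.AdmIndex (fun i => D.omegaAt i) j w))) i
        map_add' := fun w w' => by simp only [map_add, DirectSum.add_apply]
        map_smul' := fun c w => by
          rw [map_smul, map_smul, D.galoisAct_smul, map_smul]
          rfl }
    have hf : ∀ (g : D.G) (w : D.omegaAt j), f (D.rhoAt j g w) = D.rhoAt i g (f w) := by
      intro g w
      change Φ (D.galoisAct σ (Φ.symm (DirectSum.lof ℂ D.AdmIndex (fun i => D.omegaAt i) j (D.rhoAt j g w)))) i =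
        D.rhoAt i g (Φ (D.galoisAct σ (Φ.symm (DirectSum.lof ℂ D.AdmIndex (fun i => D.omegaAt i) j w))) i)
      rw [D.symm_lof_rhoAt_local Φ hΦ, D.galoisAct_baseChange, hΦ]
    intro w
    rcases Literature.RepresentationTheory.Semisimple.semilinear_eq_zero_or_bijective (D.rhoAt j) (D.rhoAt i) (hirr j) (hirr i)
        f hf with h0 | hbij
    · exact LinearMap.congr_fun h0 w
    · exact absurd (hj.symm.trans (hrig σ j i ⟨f, hbij, hf⟩)) (Ne.symm hi)
  -- decompose `x = Σ_{j ∈ supp Φx} Φ⁻¹ (ι_j (Φ x j))`; every `j` in the support has `j.ε = ε`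
  have hsum : Φ x = ∑ j ∈ (Φ x).support, DirectSum.lof ℂ D.AdmIndex (fun i => D.omegaAt i) j (Φ x j) := by
    simpa only [DirectSum.lof_eq_of] using (DirectSum.sum_support_of (Φ x)).symm
  have hx' : x = ∑ j ∈ (Φ x).support, Φ.symm (DirectSum.lof ℂ D.AdmIndex (fun i => D.omegaAt i) j (Φ x j)) := by
    rw [← map_sum, ← hsum, LinearEquiv.symm_apply_apply]
  rw [hx', map_sum, map_sum, DirectSum.sum_apply]
  refine Finset.sum_eq_zero fun j hj => ?_
  have hjε : j.1.1 = ε := by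
    by_contra hne
    exact (DFinsupp.mem_support_iff.1 hj) (hx j hne)
  exact hcomp j hjε (Φ x j)

end Thm418Data

end Literature.NumberTheory.Automorphic.Liu2021

end
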